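import Summits.NavierStokesRegularity.NavierStokesRegularity.Theorems.SoloRefuteZajaczkowski2023
import HarnessLib

/-!
# C179 `Zajaczkowski2023` — records ADDENDUM (solution grain): the forced zero-flux pipe flow inhabits the printed
setting with `ψ₁|_{r=0} = 1`, so `¬ Step3_AxisVanishing`

D-0090 NS-CLAIMS SWEEP, claim C179 (W. M. Zajączkowski, arXiv:2304.00856v1, «Global regular axially-symmetric
solutions to the Navier-Stokes equations. Part 1»), skeleton `Literature/Claims/NS/Zajaczkowski2023.lean`.
The head of record is the FUNCTION-grain binder `Step3_PlanItem3` (plan item 3 p.6 l.40–43), refuted in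
`…Theorems.SoloRefuteZajaczkowski2023` (`Zajaczkowski2023Columnar.not_Step3_PlanItem3`). This file adds the
SOLUTION-grain records object against the DERIVED decl `Step3_AxisVanishing` (p.6 l.31 «To prove (1.24) we need that
ψ₁ and v_z vanish on the axis of symmetry»; Remark 3.4 p.18 l.53–55): the steady forced pipe flow
`v = (2 − 6r² + 3r⁴) e_z`, `p = 0`, `f = (24 − 48r²) e_z = −Δv` (viscosity `ν = 1`) in the unit `2`-periodic
cylinder, with `ψ₁ = 1 − (3/2)r² + r⁴/2` (`v_r = −rψ_{1,z} = 0`, `v_z = rψ_{1,r} + 2ψ₁`), `ω_φ = 12r(1 − r²)`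
(`= 0` on the wall, `Γ = ω_φ/r = 12 − 12r² = ω₁`), is an `IsSolution 1 1 1 1 f v p ψ₁` (`isSolution_pipe`): momentum
and `div v = 0` classically, all fields `C^∞`, axisymmetric, `x₃`-independent, wall conditions (1.6)₄ and (1.22)₂,
kinematics (1.21) on `ℝ³`, and (1.22)/(3.1) off the axis — yet `ψ₁ = 1` and `v_z = 2` on the axis. Hence
`not_Step3_AxisVanishing` and `exists_isSolution_not_vanishesOnAxis`: the printed solution class of Theorem 1.2 is
inhabited (non-vacuity of the setting) by a flow outside Lemma 3.3's hypothesis `ψ₁|_{r=0} = 0`, i.e. the charitable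
restriction `ClaimedTheoremAxis` is a proper sub-class. Records only — the verdict's head and class are unchanged.

WHAT THIS IS NOT: not a claim about NS regularity or blow-up; not a claim about any author beyond the typed
locator [cite: Zajaczkowski2023, p.6 l.31; Remark 3.4 p.18 l.53–55; (1.6) p.2 l.38–49; (1.21)–(1.23) p.5].
-/

noncomputable section

set_option linter.dupNamespace false

open Set Function WithLp
open scoped ContDiff Laplacian InnerProductSpace RealInnerProductSpace

/-! ## Solution grain (records): the forced zero-flux pipe flow `v = (2 − 6r² + 3r⁴) e_z` in the unit cylinder -/

namespace Summit.NavierStokesRegularity.NavierStokesRegularity.Theorems.Zajaczkowski2023Pipe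

open Literature.Analysis.FluidPDE Literature.Claims.NS.Zajaczkowski2023
open Summit.NavierStokesRegularity.NavierStokesRegularity.Theorems.Zajaczkowski2023Columnar
open Summit.NavierStokesRegularity.NavierStokesRegularity.Theorems.RotatingEulerWindowProfileLinearRung (hasFDerivAt_coord)

/-- The axial velocity profile `W = 2 − 6ρ + 3ρ²` (`= rψ_{1,r} + 2ψ₁`, zero flux `∫₀¹ W r dr = 0`). [cite: Zajaczkowski2023, (1.21) p.5 l.3–6] -/
def wW (y : E3) : ℝ := 2 - 6 * rho y + 3 * (rho y * rho y)

/-- The coefficient `t = 6ρ − 6` of `∇W = t · (2x₀, 2x₁, 0)`. [folklore] -/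
def tW (y : E3) : ℝ := 6 * rho y - 6

/-- `DW(x) = t(x) (2x₀ dx₀ + 2x₁ dx₁)`. [folklore] -/
theorem hasFDerivAt_wW (x : E3) :
    HasFDerivAt wW ((tW x * (2 * x 0)) • (EuclideanSpace.proj (0 : Fin 3) : E3 →L[ℝ] ℝ) +
      (tW x * (2 * x 1)) • (EuclideanSpace.proj (1 : Fin 3) : E3 →L[ℝ] ℝ)) x := by
  have hρ := hasFDerivAt_rho x
  have hρρ : HasFDerivAt (fun y : E3 => rho y * rho y)
      (rho x • ((2 * x 0) • (EuclideanSpace.proj (0 : Fin 3) : E3 →L[ℝ] ℝ) +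
        (2 * x 1) • (EuclideanSpace.proj (1 : Fin 3) : E3 →L[ℝ] ℝ)) +
        rho x • ((2 * x 0) • (EuclideanSpace.proj (0 : Fin 3) : E3 →L[ℝ] ℝ) +
        (2 * x 1) • (EuclideanSpace.proj (1 : Fin 3) : E3 →L[ℝ] ℝ))) x := hρ.mul hρ
  have h : HasFDerivAt (fun y : E3 => 2 - 6 * rho y + 3 * (rho y * rho y)) _ x :=
    ((hasFDerivAt_const (2 : ℝ) x).sub (hρ.const_mul 6)).add (hρρ.const_mul 3)
  refine h.congr_fderiv ?_
  ext w
  simp [tW]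
  ring

/-- `DW(x) w = t(x) (2x₀ w₀ + 2x₁ w₁)`. [folklore] -/
theorem fderiv_wW_apply (x w : E3) :
    fderiv ℝ wW x w = tW x * (2 * x 0) * w 0 + tW x * (2 * x 1) * w 1 := by
  rw [(hasFDerivAt_wW x).fderiv]
  simp

/-- `W` is smooth. [folklore] -/
theorem contDiff_wW {n : WithTop ℕ∞} : ContDiff ℝ n wW :=
  (contDiff_const.sub (contDiff_const.mul contDiff_rho)).add (contDiff_const.mul (contDiff_rho.mul contDiff_rho))

/-- `Dt(x) = 12x₀ dx₀ + 12x₁ dx₁`. [folklore] -/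
theorem hasFDerivAt_tW (x : E3) :
    HasFDerivAt tW ((12 * x 0) • (EuclideanSpace.proj (0 : Fin 3) : E3 →L[ℝ] ℝ) +
      (12 * x 1) • (EuclideanSpace.proj (1 : Fin 3) : E3 →L[ℝ] ℝ)) x := by
  have h : HasFDerivAt (fun y : E3 => 6 * rho y - 6) _ x := ((hasFDerivAt_rho x).const_mul 6).sub_const 6
  refine h.congr_fderiv ?_
  ext w
  simp
  ring

/-- The pure second partials of `W`: `∂_j (2 t x_j) = 24x_j² + 2t` for `j = 0, 1`. [folklore] -/
theorem fderiv_gradW_comp (j : Fin 3) (hj : j = 0 ∨ j = 1) (x : E3) :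
    fderiv ℝ (fun y : E3 => tW y * (2 * y j)) x (EuclideanSpace.single j (1 : ℝ)) = 24 * x j * x j + 2 * tW x := by
  have h : HasFDerivAt (fun y : E3 => tW y * (2 * y j)) _ x :=
    (hasFDerivAt_tW x).mul ((hasFDerivAt_coord j x).const_mul 2)
  rw [h.fderiv]
  rcases hj with rfl | rfl <;> simp <;> ring

/-- **`ΔW = 48ρ − 24`.** [folklore] -/
theorem laplacian_wW (x : E3) : (Δ wW) x = 48 * rho x - 24 := by
  rw [laplacian_eq_sum_fderiv_fderiv (EuclideanSpace.basisFun (Fin 3) ℝ) (contDiff_wW (n := 2)) x,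
    Fin.sum_univ_three]
  have e0 : (fun y => fderiv ℝ wW y ((EuclideanSpace.basisFun (Fin 3) ℝ) 0)) = fun y => tW y * (2 * y 0) := by
    funext y; rw [fderiv_wW_apply]; simp
  have e1 : (fun y => fderiv ℝ wW y ((EuclideanSpace.basisFun (Fin 3) ℝ) 1)) = fun y => tW y * (2 * y 1) := by
    funext y; rw [fderiv_wW_apply]; simp
  have e2 : (fun y => fderiv ℝ wW y ((EuclideanSpace.basisFun (Fin 3) ℝ) 2)) = fun _ => (0 : ℝ) := by
    funext y; rw [fderiv_wW_apply]; simp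
  have z2 : fderiv ℝ (fun _ : E3 => (0 : ℝ)) x ((EuclideanSpace.basisFun (Fin 3) ℝ) 2) = 0 := by simp
  rw [e0, e1, e2, z2]
  simp only [EuclideanSpace.basisFun_apply]
  rw [fderiv_gradW_comp 0 (Or.inl rfl) x, fderiv_gradW_comp 1 (Or.inr rfl) x]
  unfold tW rho
  ring

/-! ### The fields: `v = W e_z` (steady), `p = 0`, `f = (24 − 48ρ) e_z` (`= −Δv`, `ν = 1`), `ψ₁(t) = ψ₁` -/

/-- The pipe-flow velocity `v(t, x) = W(x) e_z`. [cite: Zajaczkowski2023, (1.6) p.2 l.38–49] -/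
def vP : ℝ → E3 → E3 := fun _ y => wW y • eZ

/-- The pressure `p = 0`. [folklore] -/
def pP : ℝ → E3 → ℝ := fun _ _ => 0

/-- The force `f = (24 − 48ρ) e_z = −Δv` (viscosity `ν = 1`). [cite: Zajaczkowski2023, (1.6) p.2 l.38–49] -/
def fP : ℝ → E3 → E3 := fun _ y => (24 - 48 * rho y) • eZ

/-- The stream variable along the flow: `ψ₁(t) = ψ₁` of the columnar witness at every time. [cite: Zajaczkowski2023, (1.21) p.5 l.3–6] -/
def psiP : ℝ → E3 → ℝ := fun _ => psiW

/-- `Dv(x) = DW(x) ⊗ e_z`. [folklore] -/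
theorem hasFDerivAt_vP (t : ℝ) (x : E3) :
    HasFDerivAt (vP t) ((fderiv ℝ wW x).smulRight eZ) x :=
  (hasFDerivAt_wW x).differentiableAt.hasFDerivAt.smul_const eZ

/-- `Dv(x) w = (DW(x) w) e_z`. [folklore] -/
theorem fderiv_vP_apply (t : ℝ) (x w : E3) : fderiv ℝ (vP t) x w = (fderiv ℝ wW x w) • eZ := by
  rw [(hasFDerivAt_vP t x).fderiv]
  simp

/-- `v` is steady: `∂ₜ v = 0` (within any time set). [folklore] -/
theorem timeDerivWithin_vP (S : Set ℝ) (t : ℝ) (x : E3) : timeDerivWithin S vP t x = 0 := by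
  simp [timeDerivWithin, vP]

/-- `(v·∇)v = 0` (the flow is columnar: `W` does not vary along `e_z`). [folklore] -/
theorem convect_vP (t : ℝ) (x : E3) : convect (vP t) (vP t) x = 0 := by
  rw [convect_apply, fderiv_vP_apply, fderiv_wW_apply]
  simp [vP, eZ]

/-- `Δv = (48ρ − 24) e_z`. [folklore] -/
theorem laplacian_vP (t : ℝ) (x : E3) : (Δ (vP t)) x = (48 * rho x - 24) • eZ := by
  have h : vP t = (ContinuousLinearMap.toSpanSingleton ℝ (eZ : E3)) ∘ wW := by
    funext y; simp [vP, ContinuousLinearMap.toSpanSingleton_apply]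
  rw [h, (contDiff_wW (n := 2)).contDiffAt.laplacian_CLM_comp_left]
  simp [laplacian_wW, ContinuousLinearMap.toSpanSingleton_apply]

/-- `∇p = 0`. [folklore] -/
theorem gradient_pP (t : ℝ) (x : E3) : gradient (pP t) x = 0 := by
  show gradient (fun _ : E3 => (0 : ℝ)) x = 0
  exact gradient_fun_const x 0

/-- `div v = 0`. [folklore] -/
theorem divergence_vP (t : ℝ) (x : E3) : VectorCalculus.divergence (vP t) x = 0 := by
  rw [divergence_eq_sum_inner_fderiv (EuclideanSpace.basisFun (Fin 3) ℝ), Fin.sum_univ_three]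
  simp [EuclideanSpace.basisFun_apply, fderiv_vP_apply, fderiv_wW_apply, EuclideanSpace.inner_single_left, eZ]

/-- `curl v = (2t x₁, −2t x₀, 0)` (`ω = ω_φ e_φ`, `ω_φ = −W'(r) = 12r(1 − r²)`). [folklore] -/
theorem curl_vP (t : ℝ) (x : E3) :
    curl (vP t) x = toLp 2 ![tW x * (2 * x 1), -(tW x * (2 * x 0)), 0] := by
  unfold curl
  simp only [fderiv_vP_apply, fderiv_wW_apply]
  ext i
  fin_cases i <;> simp [eZ]

/-- `v_r = 0`. [folklore] -/
theorem radialVelocity_vP (t : ℝ) (x : E3) : radialVelocity (vP t) x = 0 := by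
  simp [radialVelocity, vP, eR, eZ, PiLp.inner_apply]

/-- `v_φ = 0`. [folklore] -/
theorem swirlVelocity_vP (t : ℝ) (x : E3) : swirlVelocity (vP t) x = 0 := by
  simp [swirlVelocity, vP, eTheta, eZ, PiLp.inner_apply]

/-- `v_z = W`. [folklore] -/
theorem axialVelocity_vP (t : ℝ) (x : E3) : axialVelocity (vP t) x = wW x := by
  simp [axialVelocity, vP, eZ]

/-- `ω_φ = −2 t r = 12 r (1 − r²)`. [folklore] -/
theorem swirlVelocity_curl_vP (t : ℝ) (x : E3) :
    swirlVelocity (curl (vP t)) x = -(2 * tW x * cylRadius x) := by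
  unfold swirlVelocity
  rw [curl_vP]
  by_cases hx : cylRadius x = 0
  · simp [eTheta, hx]
  · have hr2 : cylRadius x ^ 2 = x 0 ^ 2 + x 1 ^ 2 := cylRadius_sq x
    have e : ⟪(toLp 2 ![tW x * (2 * x 1), -(tW x * (2 * x 0)), 0] : E3), eTheta x⟫ =
        -(2 * tW x * (cylRadius x)⁻¹ * (x 0 ^ 2 + x 1 ^ 2)) := by
      simp [eTheta, PiLp.inner_apply, Fin.sum_univ_three]
      ring
    rw [e, ← hr2]
    calc -(2 * tW x * (cylRadius x)⁻¹ * cylRadius x ^ 2)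
          = -(2 * tW x * ((cylRadius x)⁻¹ * cylRadius x) * cylRadius x) := by ring
      _ = -(2 * tW x * cylRadius x) := by rw [inv_mul_cancel₀ hx]; ring

/-- `Γ = ω_φ / r = −2t = 12 − 12ρ = ω₁` off the axis. [cite: Zajaczkowski2023, (1.23) p.5 l.19] -/
theorem gammaOf_vP {t : ℝ} {x : E3} (hx : cylRadius x ≠ 0) : GammaOf vP t x = omW x := by
  unfold GammaOf
  rw [swirlVelocity_curl_vP]
  unfold omW tW
  field_simp
  ring

/-- `r ψ_{1,r} = s ρ` everywhere (on the axis both sides vanish). [folklore] -/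
theorem cylRadius_mul_dR_psiW (x : E3) : cylRadius x * dR psiW x = sW x * rho x := by
  by_cases hx : cylRadius x = 0
  · have : rho x = 0 := by rw [rho_eq_cylRadius_sq, hx]; ring
    rw [hx, this]; ring
  · rw [dR_psiW hx, rho_eq_cylRadius_sq]; ring

/-- `ψ_{1,z} = 0`. [folklore] -/
theorem dZ_psiW (x : E3) : dZ psiW x = 0 := by
  unfold dZ
  rw [fderiv_psiW_apply]
  simp [eZ]

/-- `rotZ θ` fixes multiples of `e_z`. [folklore] -/
theorem rotZ_smul_eZ (θ c : ℝ) : rotZ θ (c • (eZ : E3)) = c • eZ := by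
  ext i
  fin_cases i <;> simp [rotZ, eZ]

/-- `ρ ∘ rotZ θ = ρ`. [folklore] -/
theorem rho_rotZ (θ : ℝ) (x : E3) : rho (rotZ θ x) = rho x := by
  rw [rho_eq_cylRadius_sq, rho_eq_cylRadius_sq, cylRadius_rotZ]

/-- Joint smoothness of a time-independent scalar. [folklore] -/
theorem contDiff_uncurry_const_time {g : E3 → ℝ} (hg : ContDiff ℝ ∞ g) :
    ContDiff ℝ ∞ (uncurry fun (_ : ℝ) (y : E3) => g y) :=
  hg.comp contDiff_snd

/-- Joint smoothness of `(t, x) ↦ g(x) e_z`. [folklore] -/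
theorem contDiff_uncurry_smul_eZ {g : E3 → ℝ} (hg : ContDiff ℝ ∞ g) :
    ContDiff ℝ ∞ (uncurry fun (_ : ℝ) (y : E3) => g y • (eZ : E3)) :=
  (hg.comp contDiff_snd).smul contDiff_const

/-- **The forced pipe flow is a solution of the printed setting** (`IsSolution 1 1 1 1 f v p ψ₁`): steady
`v = (2 − 6r² + 3r⁴) e_z`, `p = 0`, `f = (24 − 48r²) e_z = −Δv`, with `ψ₁ = 1 − (3/2)r² + r⁴/2`; momentum and
`div v = 0` hold classically, all fields are `C^∞`, axisymmetric and `x₃`-independent, `v_r = v_φ = ω_φ = ψ₁ = 0`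
on `{r = 1}`, (1.21) holds on `ℝ³`, and (1.22)/(3.1) holds with `ω₁ = 12 − 12ρ = Γ` off the axis.
[cite: Zajaczkowski2023, (1.6) p.2 l.38–49; (1.21)–(1.23) p.5] -/
theorem isSolution_pipe : IsSolution 1 1 1 1 fP vP pP psiP where
  R_pos := one_pos
  a_pos := one_pos
  ν_pos := one_pos
  T_pos := one_pos
  ns :=
    { smooth_velocity := (contDiff_uncurry_smul_eZ contDiff_wW).contDiffOn
      smooth_pressure := (contDiff_const : ContDiff ℝ ∞ (uncurry pP)).contDiffOn
      momentum := fun t _ x _ => by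
        rw [timeDerivWithin_vP, convect_vP, laplacian_vP, gradient_pP]
        simp only [fP, one_smul, sub_zero, zero_add]
        rw [← add_smul]
        ring_nf
        simp
      divFree := fun t _ x _ => divergence_vP t x }
  smooth_v := contDiff_uncurry_smul_eZ contDiff_wW
  smooth_p := contDiff_const
  smooth_f := contDiff_uncurry_smul_eZ (contDiff_const.sub (contDiff_const.mul contDiff_rho))
  smooth_ψ := contDiff_uncurry_const_time contDiff_psiW
  axisym := fun t =>
    ⟨fun θ x => by simp only [vP, rho_rotZ, wW, rotZ_smul_eZ],
      fun θ x => by simp only [fP, rho_rotZ, rotZ_smul_eZ],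
      fun θ x => rfl, isAxisymmetricScalar_psiW⟩
  periodic := fun t =>
    ⟨fun x => by simp only [vP, wW, rho_add_axial], fun x => rfl,
      fun x => by simp only [fP, rho_add_axial], isAxiallyPeriodic_psiW _⟩
  wall := fun t _ x hx => by
    refine ⟨radialVelocity_vP t x, swirlVelocity_vP t x, ?_, psiW_wall hx⟩
    rw [swirlVelocity_curl_vP, hx]
    have : rho x = 1 := by rw [rho_eq_cylRadius_sq, hx]; norm_num
    unfold tW; rw [this]; ring
  stream := fun t _ x _ => by
    refine ⟨?_, ?_⟩
    · rw [radialVelocity_vP]; simp [psiP, dZ_psiW]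
    · rw [axialVelocity_vP]
      show wW x = cylRadius x * dR psiW x + 2 * psiW x
      rw [cylRadius_mul_dR_psiW]
      unfold wW sW psiW
      ring
  stream_eq := fun t _ => ⟨omW, solvesStream_psiW, fun x _ hx => (gammaOf_vP hx).symm⟩

/-- Along the pipe flow `ψ₁ = 1` on the axis at every time. [folklore] -/
theorem psiP_axisPt (t z : ℝ) : psiP t (axisPt z) = 1 := psiW_axisPt z

/-- **Records object — `¬ Step3_AxisVanishing`** (solution grain, p.6 l.31 «To prove (1.24) we need that ψ₁ and
v_z vanish on the axis of symmetry»; DERIVED from the head `Step3_PlanItem3`): the forced zero-flux pipe flow is a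
solution of the printed setting whose `ψ₁` equals `1` (and whose `v_z` equals `2`) on the axis. [cite: Zajaczkowski2023, p.6 l.31; Remark 3.4 p.18 l.53–55] -/
theorem not_Step3_AxisVanishing : ¬ Step3_AxisVanishing := by
  intro h
  have h0 := (h 1 1 1 1 fP vP pP psiP isSolution_pipe 0 ⟨le_rfl, one_pos⟩ 0).1
  rw [psiP_axisPt] at h0
  exact one_ne_zero h0

/-- The printed solution class is inhabited by a flow with `ψ₁|_{r=0} ≠ 0`: the charitable restriction
`ClaimedTheoremAxis` (Lemma 3.3's hypothesis `ψ₁|_{r=0} = 0`) is a PROPER sub-class of Theorem 1.2's. [cite: Zajaczkowski2023, Remark 3.4 p.18 l.53–55] -/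
theorem exists_isSolution_not_vanishesOnAxis :
    ∃ (f v : ℝ → E3 → E3) (p : ℝ → E3 → ℝ) (ψ₁ : ℝ → E3 → ℝ),
      IsSolution 1 1 1 1 f v p ψ₁ ∧ ¬ VanishesOnAxis 1 ψ₁ :=
  ⟨fP, vP, pP, psiP, isSolution_pipe, fun h => by
    have h0 := h 0 ⟨le_rfl, one_pos⟩ 0
    rw [psiP_axisPt] at h0
    exact one_ne_zero h0⟩

end Summit.NavierStokesRegularity.NavierStokesRegularity.Theorems.Zajaczkowski2023Pipe

end

-- WHAT THIS IS NOT: not a claim about NS regularity or blow-up; not a claim about any author beyond the typed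
-- locator.
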